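import Summits.ABC.ABC.Theorems.DefiniteXiFreyModularityStubAbsIrrNegThree
import Literature.NumberTheory.DiophantineGeometry.GeneralizedFermatTwoPowerCoefficientFreyProofs
import Literature.NumberTheory.Automorphic.CDTTheorem722
import HarnessLib

/-!
# `stub_liftThree` — ideator k3 (GEN 12), HOME FAMILY 3 "probe the extremes": typed companion

Companion of `STUB-IDEAS-stub_liftThree-3.md` (gen 12, saturation audit).  Self-contained (imports
only landed files).  Crux `FreyModularity` (item `stmt-ABC-11340`), line `Lines/Sketch.lean`, stub
  `stub_liftThree : ∀ W [IsElliptic] ρ, W.IsTorsionGaloisRep 3 ρ → ρ.IsAbsIrreducibleOverSqrt (-3) →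
     ¬ 9 ∣ N_W → ρ.IsModular → W.IsModularGaloisRepTate 3`.

New here — ONE extremal configuration not witnessed by gens 2–11, typed over TREE vocabulary only
(no new predicate): inside the multiplicative-at-`3` regime (`LiftThreeMult`; gen-9 M-chain:
multiplicative ⇒ ordinary) the sub-cell
  `β₀ := {W multiplicative at 3, 3 ∣ ord₃ Δ_min(W)}`   (`E[3]|_{D₃}` FINITE FLAT, `T₃E` NOT crystalline)
is the unique cell of the stub on which the minimal deformation condition at `ℓ = 3` ("good at 3",
forced by `ρ̄`) does NOT contain `ρ_{E,3^∞}`: the Wiles/DDT induction must ENLARGE `Σ` AT `q = ℓ = 3`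
(Wiles 1995 Ch. 2 §2 "q = p"; DDT 1995 §2.7–2.8 + the `T`-side factor at `p`), the one step that
no lane (k1 Plan 7, k2 Σ-engine, k3 cells) has typed.  Its complement `β₁ := {multiplicative at 3,
3 ∤ ord₃ Δ_min}` (`ρ̄|_{D₃}` not finite: `3 ∈ Σ` from the start) was witnessed in gen 3/6
(`E_(-1,-2)`, `E_(1,3) = 24a1`).  Certified small case: `β₀` is met IN THE FREY FAMILY, IN CASE A, by
  `E_(1,26)` (`1 + 26 = 27`, `abc = 702 = 2·3³·13`): multiplicative at `3`, `ord₃ Δ_min = 2·3 = 6`,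
  `3 ∣ 6`; `5 ∤ 702` so `a₅ = ±2` and `E[3]|_{ℚ(√-3)}` is abs. irreducible by gen-3 E8
  (`isAbsIrreducibleOverSqrt_negThree_freyCurve_of_not_five_dvd`, proved in
  `STUB_IDEAS_stub_liftThree_3g3.lean`, unlanded — hence quoted, not imported).
Contents: W0 the cells as Props + the (trivial, kernel-checked) glue `β₀ → β₁ → Mult` and
`stub → β₀, β₁`; W1 arithmetic certificate of `(1, 26, 27)`; W2 `E_(1,26) ∈ β₀`;
W3 `E_(-1,-2) ∈ β₁` (contrast, gen-3 E6's curve); W4 the non-`hirr` hypotheses of the stub for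
`E_(1,26)` (`9 ∤ N`, a framing of `E[3]` exists).
-/

noncomputable section

open scoped MatrixGroups NumberField
open IsDedekindDomain WeierstrassCurve Rat.HeightOneSpectrum
open Literature.NumberTheory.EllipticCurves
open Literature.NumberTheory.Automorphic Literature.NumberTheory.Automorphic.BCDT
open Literature.NumberTheory.GaloisRepresentations
open Literature.NumberTheory.DiophantineGeometry
open Summit.ABC.ABC.Theorems

namespace Summit.ABC.ABC.Cruxes.FreyModularity.StubIdeas3G12

/-! ## W0. The multiplicative regime and its two cells `β₀`, `β₁` (tree vocabulary only) -/

/-- The stub, verbatim (for the direction `stub → cells`). -/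
def LiftThree : Prop :=
  ∀ (W : WeierstrassCurve ℚ) [W.IsElliptic] (ρ : ModPGaloisRep ℚ (ZMod 3) 2),
    W.IsTorsionGaloisRep 3 ρ → ρ.IsAbsIrreducibleOverSqrt (-3) → ¬ 9 ∣ W.conductorNorm ℤ →
      ρ.IsModular → W.IsModularGaloisRepTate 3

/-- `LiftThreeMult`: the stub on {`W` multiplicative at the place `v₃` above `3`} (then `ρ_{W,3^∞}`
is ordinary, gen-9 M-chain; `f₃(W) = 1` so `9 ∤ N` holds automatically at `3`). -/
def LiftThreeMult : Prop :=
  ∀ (W : WeierstrassCurve ℚ) [W.IsElliptic] (ρ : ModPGaloisRep ℚ (ZMod 3) 2),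
    W.IsTorsionGaloisRep 3 ρ → ρ.IsAbsIrreducibleOverSqrt (-3) → ¬ 9 ∣ W.conductorNorm ℤ →
      ρ.IsModular → ∀ v : HeightOneSpectrum ℤ, natGenerator v = 3 →
        W.HasMultiplicativeReductionAt v → W.IsModularGaloisRepTate 3

/-- **Cell `β₀`** — multiplicative at `3` AND `3 ∣ ord₃ Δ_min`: `E[3]|_{D₃}` is finite flat (Tate
curve: `E[3] ↔ q^{1/3}`, `3 ∣ v₃(q)`), while `T₃E` is ordinary non-crystalline.  The minimal
(`ρ̄`-dictated) local condition at `3` is "good/flat", which `T₃E` violates: the modularity of `T₃E`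
is reached only after the `Σ`-increment at `q = ℓ = 3`. -/
def LiftThreeBeta0 : Prop :=
  ∀ (W : WeierstrassCurve ℚ) [W.IsElliptic] (ρ : ModPGaloisRep ℚ (ZMod 3) 2),
    W.IsTorsionGaloisRep 3 ρ → ρ.IsAbsIrreducibleOverSqrt (-3) → ¬ 9 ∣ W.conductorNorm ℤ →
      ρ.IsModular → ∀ v : HeightOneSpectrum ℤ, natGenerator v = 3 →
        W.HasMultiplicativeReductionAt v → 3 ∣ W.ordMinimalDiscriminant v →
          W.IsModularGaloisRepTate 3

/-- **Cell `β₁`** — multiplicative at `3` and `3 ∤ ord₃ Δ_min`: `ρ̄|_{D₃}` is NOT finite (weight-`4`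
type), the minimal condition at `3` is already "ordinary, `3 ∈ Σ`", no increment at `3` is needed
(witnesses: `E_(-1,-2)` below, `E_(1,3) = 24a1` of gen 6). -/
def LiftThreeBeta1 : Prop :=
  ∀ (W : WeierstrassCurve ℚ) [W.IsElliptic] (ρ : ModPGaloisRep ℚ (ZMod 3) 2),
    W.IsTorsionGaloisRep 3 ρ → ρ.IsAbsIrreducibleOverSqrt (-3) → ¬ 9 ∣ W.conductorNorm ℤ →
      ρ.IsModular → ∀ v : HeightOneSpectrum ℤ, natGenerator v = 3 →
        W.HasMultiplicativeReductionAt v → ¬ 3 ∣ W.ordMinimalDiscriminant v →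
          W.IsModularGaloisRepTate 3

/-- Glue (kernel-checked): the multiplicative regime is exactly `β₀ ∪ β₁`. -/
theorem liftThreeMult_of_beta0_of_beta1 : LiftThreeBeta0 → LiftThreeBeta1 → LiftThreeMult := by
  intro h0 h1 W _ ρ hρ hirr h9 hmod v hv hmult
  by_cases h3 : 3 ∣ W.ordMinimalDiscriminant v
  · exact h0 W ρ hρ hirr h9 hmod v hv hmult h3
  · exact h1 W ρ hρ hirr h9 hmod v hv hmult h3

/-- No costume: each cell is a WEAKENING of the stub (extra hypotheses only). -/
theorem liftThreeBeta0_of_liftThree : LiftThree → LiftThreeBeta0 :=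
  fun h W _ ρ hρ hirr h9 hmod _ _ _ _ ↦ h W ρ hρ hirr h9 hmod

theorem liftThreeBeta1_of_liftThree : LiftThree → LiftThreeBeta1 :=
  fun h W _ ρ hρ hirr h9 hmod _ _ _ _ ↦ h W ρ hρ hirr h9 hmod

theorem liftThreeMult_of_liftThree : LiftThree → LiftThreeMult :=
  fun h W _ ρ hρ hirr h9 hmod _ _ _ ↦ h W ρ hρ hirr h9 hmod

/-! ## W1. Arithmetic certificate of the triple `1 + 26 = 27` -/

/-- `(a, b, c) = (1, 26, 27)`: coprime, `abc = 702 ≠ 0`, `3 ∣ abc` (multiplicative at `3`),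
`27 ∣ abc ∧ 81 ∤ abc` (`v₃(abc) = 3`, so `ord₃ Δ_min = 6 ≡ 0 mod 3`: cell `β₀`), `5 ∤ abc`
(case A via E8: `a₅ = ±2`), `13 ∥ abc` (`ord₁₃ Δ = 2`, `3 ∤ 2`: `ρ̄` ramified at `13`, so `13` is
not a level-lowering prime), `2 ∥ b` (additive at `2` — allowed: the stub is CDT-strength away
from `3`). -/
theorem beta0_witness_arith :
    IsCoprime (1 : ℤ) 26 ∧ (1 : ℤ) * 26 * (1 + 26) = 702 ∧ (1 : ℤ) * 26 * (1 + 26) ≠ 0 ∧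
      (3 : ℤ) ∣ 702 ∧ (27 : ℤ) ∣ 702 ∧ ¬ (81 : ℤ) ∣ 702 ∧ ¬ (5 : ℤ) ∣ 702 ∧
      (13 : ℤ) ∣ 702 ∧ ¬ (169 : ℤ) ∣ 702 ∧ (2 : ℤ) ∣ 26 ∧ ¬ (4 : ℤ) ∣ 26 := by
  refine ⟨isCoprime_one_left, ?_⟩
  norm_num

/-- `v₃(702) = 3` as a `padicValInt` (the quantity in `ordMinimalDiscriminant_freyCurve_of_ne_two`). -/
theorem padicValInt_three_abc_one_twentySix : padicValInt 3 ((1 : ℤ) * 26 * (1 + 26)) = 3 := by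
  have e : ((1 : ℤ) * 26 * (1 + 26)).natAbs = 3 ^ 3 * 26 := by decide
  rw [padicValInt, e, padicValNat.mul (by decide) (by decide), padicValNat.prime_pow,
    padicValNat.eq_zero_of_not_dvd (by decide)]

/-! ## W2. `E_(1,26)` lies in cell `β₀` -/

/-- **`E_(1,26) ∈ β₀`**: multiplicative at the place above `3` and `ord₃ Δ_min = 6`.
[cite: Serre1987, §4.1 (4.1.2), (4.1.9)] -/
theorem freyCurve_one_twentySix_beta0 (v : HeightOneSpectrum ℤ) (hv : natGenerator v = 3) :
    (freyCurve 1 26).HasMultiplicativeReductionAt v ∧ (freyCurve 1 26).ordMinimalDiscriminant v = 6 := by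
  have hab : IsCoprime (1 : ℤ) 26 := isCoprime_one_left
  have h0 : (1 : ℤ) * 26 * (1 + 26) ≠ 0 := by norm_num
  have h2 : natGenerator v ≠ 2 := by rw [hv]; decide
  refine ⟨hasMultiplicativeReductionAt_freyCurve_of_ne_two hab h0 v h2 (by rw [hv]; norm_num), ?_⟩
  rw [ordMinimalDiscriminant_freyCurve_of_ne_two hab h0 v h2, hv,
    padicValInt_three_abc_one_twentySix]

/-- Hence `3 ∣ ord₃ Δ_min(E_(1,26))`: the `β₀` side condition of `LiftThreeBeta0` is met. -/
theorem three_dvd_ordMinimalDiscriminant_freyCurve_one_twentySix (v : HeightOneSpectrum ℤ)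
    (hv : natGenerator v = 3) : 3 ∣ (freyCurve 1 26).ordMinimalDiscriminant v := by
  rw [(freyCurve_one_twentySix_beta0 v hv).2]; decide

/-! ## W3. Contrast: `E_(-1,-2)` (gen-3 E6, `1 + 2 = 3`) lies in cell `β₁` -/

/-- **`E_(-1,-2) ∈ β₁`**: multiplicative at `3` with `ord₃ Δ_min = 2`, `3 ∤ 2` (`ρ̄|_{D₃}` not
finite) — so gen-3's inhabitant of {multiplicative at `3`} × {case A} does NOT exercise the
`q = ℓ = 3` increment; `E_(1,26)` is the first Frey curve in case A that does. -/
theorem freyCurve_negOne_negTwo_beta1 (v : HeightOneSpectrum ℤ) (hv : natGenerator v = 3) :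
    (freyCurve (-1) (-2)).HasMultiplicativeReductionAt v ∧
      (freyCurve (-1) (-2)).ordMinimalDiscriminant v = 2 ∧
      ¬ 3 ∣ (freyCurve (-1) (-2)).ordMinimalDiscriminant v := by
  have hab : IsCoprime (-1 : ℤ) (-2) := isCoprime_one_left.neg_left
  have h0 : (-1 : ℤ) * (-2) * (-1 + -2) ≠ 0 := by norm_num
  have h2 : natGenerator v ≠ 2 := by rw [hv]; decide
  have hord : (freyCurve (-1) (-2)).ordMinimalDiscriminant v = 2 := by
    have e : ((-1 : ℤ) * (-2) * (-1 + -2)).natAbs = 3 ^ 1 * 2 := by decide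
    rw [ordMinimalDiscriminant_freyCurve_of_ne_two hab h0 v h2, hv, padicValInt, e,
      padicValNat.mul (by decide) (by decide), padicValNat.prime_pow,
      padicValNat.eq_zero_of_not_dvd (by decide)]
  refine ⟨hasMultiplicativeReductionAt_freyCurve_of_ne_two hab h0 v h2 (by rw [hv]; norm_num),
    hord, ?_⟩
  rw [hord]; decide

/-! ## W4. The remaining (non-`hirr`) hypotheses of the stub for `E_(1,26)` -/

/-- `E_(1,26)` meets the stub's hypotheses other than `hirr` and `hmod`: it is an elliptic curve with
`9 ∤ N` (`not_nine_dvd_conductorNorm_freyCurve`, landed) and `E[3]` has a framing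
(`exists_isTorsionGaloisRep`).  `hirr` is gen-3 E8 at `5 ∤ 702`; `hmod` is Langlands–Tunnell
(`stub_LT`).  So `β₀ ∩ {case A} ∩ {Frey family} ∋ E_(1,26)`: `LiftThreeBeta0` is exercised by the
composition `isModular_freyCurve_of_stubs` at site (A). -/
theorem freyCurve_one_twentySix_stub_hypotheses :
    (freyCurve 1 26).IsElliptic ∧ ¬ 9 ∣ (freyCurve 1 26).conductorNorm ℤ ∧
      ¬ (5 : ℤ) ∣ 1 * 26 * (1 + 26) ∧
      ∃ ρ : ModPGaloisRep ℚ (ZMod 3) 2, (freyCurve 1 26).IsTorsionGaloisRep 3 ρ := by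
  have hab : IsCoprime (1 : ℤ) 26 := isCoprime_one_left
  have h0 : (1 : ℤ) * 26 * (1 + 26) ≠ 0 := by norm_num
  haveI := isElliptic_freyCurve h0
  haveI : Fact (Nat.Prime 3) := ⟨Nat.prime_three⟩
  exact ⟨inferInstance, not_nine_dvd_conductorNorm_freyCurve hab h0, by norm_num,
    (freyCurve 1 26).exists_isTorsionGaloisRep 3⟩

end Summit.ABC.ABC.Cruxes.FreyModularity.StubIdeas3G12

end
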